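import Summits.Langlands.Langlands.Theses.FrobeniusMomentIrreducibility
import Literature.NumberTheory.GaloisRepresentations.GaloisRepFrobeniusProofs
import Literature.NumberTheory.LFunctions.NumberFieldDirichletDensity
import Literature.FieldTheory.AlgClosed.PadicAlgClEquivComplex

/-!
# `MeanSquareTraceAtLeastOne` (crux A, item stmt-Langlands-19272, route
# `FrobeniusMomentIrreducibility`): degenerate instances, tightness and load-bearing hypotheses
# (negative-side support, refuter crux-attack seat — this file does NOT refute the crux)

The crux says: for a rank-`m ≥ 1`, a.e.-unramified, de Rham (for the pinned Fontaine datum above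
`ℓ`), `ι`-pure-of-weight-`w` Galois representation `ρ` of a number field `F`,
`Σ_v |ι tr ρ(Frob_v)|² N(v)^{-(w+σ)} ≥ (1-ε) log (1/(σ-1))` as `σ → 1⁺`.

Recorded here, sorry-free:

1. NON-VACUITY (`hypotheses_satisfiable`): the three hypotheses hold for the trivial
   representation of every rank `m`, over every `F`, for every `ℓ`, `ι` (weight `w = 0`);
   `frobCharpoly v 1 = (X - 1)^m` and `frobTrace v 1 = m` at EVERY place (the pinned Frobenius
   characteristic polynomial, via `hasFrobCharpolyAt`).
2. THE DEGENERATE INSTANCE IS TRUE (`conclusion_holds_trivialRep`): for `ρ = 1`, `m ≥ 1`, `w = 0`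
   the `∑'` is the genuine series `m² · Σ_v N(v)^{-σ}` and `Σ_v N(v)^{-σ} / log (1/(σ-1)) → 1`
   (Dedekind pole, `NumberField.tendsto_tsum_indicator_absNorm_div_log`).
3. TIGHTNESS (`conclusion_tight_trivialChar`): for the trivial character the constant `1` is
   attained — the strengthening with `1 + δ` in place of `1 - ε` is FALSE; the main term has no slack.
4. LOAD-BEARING HYPOTHESES:
   * `meanSquareTrace_false_without_rank_pos` — delete the guard `0 < m` and the statement is FALSE
     (rank `0`: mean square `0`; witness `F = ℚ`, `ℓ = 2`, `ρ = 1`, `w = 0`, `ε = 1/2`) — the same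
     `n = 0` pattern as the refutation of `OrdinaryPrimeTransport.RankinSelbergPoleCount`
     (stmt-Langlands-17212), correctly excluded here by the guard;
   * `meanSquareTrace_false_without_purity` — delete the purity clause (H3) and the statement is
     FALSE (the weight `w` becomes free: `ρ = 1`, `m = 1`, `w = 2` gives the bounded series
     `Σ_v N(v)^{-(2+σ)} ≤ Σ_v N(v)^{-2}` against `(1-ε) log (1/(σ-1)) → ∞`).
   The de Rham clause (H2) is load-bearing on paper only: `ρ = 1 ⊕ χ`, `χ = ⟨χ_cyc⟩^s` with
   `s ∈ ℤ_ℓ ∖ ℚ` generic, is a.e. unramified and `ι`-pure of weight `0` for every `ι`, and a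
   Steinitz `ι` sending the (algebraically independent) `χ(Frob_p)` to unit complex numbers
   clustering at `-1` makes `|1 + ι χ(Frob_p)|² → 0`, so the mean square is `0`; such `ρ` is not
   de Rham — no Lean witness is attempted here.

Moral for provers: any proof must use `0 < m` and the weight normalisation coming from purity; the
constant `1` cannot be improved; the trivial representation is the extremal (tight) case in rank 1.
-/

open Literature.NumberTheory.GaloisRepresentations Literature.NumberTheory.PAdicHodge
  IsDedekindDomain NumberField Filter Polynomial
open scoped Topology

noncomputable section

set_option linter.dupNamespace false

namespace Summit.Langlands.Langlands.Theorems.MeanSquareTraceAtLeastOne.Negative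

variable (F : Type) [Field F] [NumberField F] (m : ℕ) (ℓ : ℕ) [Fact ℓ.Prime]

omit [NumberField F] in
/-- The trivial framed representation takes the value `1` (the identity matrix) everywhere. -/
theorem one_apply_val (g : Field.absoluteGaloisGroup F) :
    ((1 : FramedGaloisRep F (PadicAlgCl ℓ) m) g).val = 1 := rfl

omit [NumberField F] in
/-- The trivial framed representation is unramified at every finite place. -/
theorem one_isUnramifiedAt (v : HeightOneSpectrum (𝓞 F)) :
    (1 : FramedGaloisRep F (PadicAlgCl ℓ) m).IsUnramifiedAt v :=
  fun _ _ _ _ => rfl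

/-- The restriction of the trivial representation to every decomposition group is locally
unramified (trivial on inertia). -/
theorem one_toLocal_isLocallyUnramified (v : HeightOneSpectrum (𝓞 F)) :
    ((1 : FramedGaloisRep F (PadicAlgCl ℓ) m).toLocal v).IsLocallyUnramified :=
  fun σ _ => by rw [FramedGaloisRep.toLocal_apply]; rfl

/-- The trivial representation is de Rham at every `v ∣ ℓ` for the PINNED Fontaine datum
`fontainePstAdicCompletion v ℓ hv` (unramified ⇒ de Rham, a structure field of the datum). -/
theorem one_isDeRhamFramed (v : HeightOneSpectrum (𝓞 F)) (hv : ((ℓ : ℕ) : 𝓞 F) ∈ v.asIdeal) :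
    (fontainePstAdicCompletion v ℓ hv).IsDeRhamFramed
      ((1 : FramedGaloisRep F (PadicAlgCl ℓ) m).toLocal v) :=
  PstWeilDeligneData.isDeRhamFramed_of_isLocallyUnramified _
    (one_toLocal_isLocallyUnramified F m ℓ v)

omit [NumberField F] in
/-- The characteristic polynomial of the trivial rank-`m` representation at any group element is
`(X - 1)^m`. -/
theorem charpoly_one_eq (g : Field.absoluteGaloisGroup F) :
    FramedRep.charpoly (1 : FramedGaloisRep F (PadicAlgCl ℓ) m) g = (X - 1) ^ m := by
  rw [FramedRep.charpoly, one_apply_val, Matrix.charpoly_one, Fintype.card_fin]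

/-- The (pinned) Frobenius characteristic polynomial of the trivial rank-`m` representation is
`(X - 1)^m` at EVERY finite place `v` (no exceptional set: `1` is unramified everywhere). -/
theorem frobCharpoly_one (v : HeightOneSpectrum (𝓞 F)) :
    (1 : FramedGaloisRep F (PadicAlgCl ℓ) m).toGaloisRep.frobCharpoly v = (X - 1) ^ m := by
  apply GaloisRep.IsUnramifiedAt.frobCharpoly_eq_of_hasFrobCharpolyAt
  · exact (FramedGaloisRep.isUnramifiedAt_toGaloisRep_iff v _).mpr (one_isUnramifiedAt F m ℓ v)
  · rw [FramedGaloisRep.hasFrobCharpolyAt_toGaloisRep_iff]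
    intro 𝔓 _ σ _
    exact charpoly_one_eq F m ℓ σ

/-- The trivial representation is `ι`-pure of weight `0` at every place: all Frobenius roots are
`1`, of absolute value `N(v)^0`. -/
theorem one_pure (ι : PadicAlgCl ℓ ≃+* ℂ) (v : HeightOneSpectrum (𝓞 F)) :
    ∀ z ∈ (((1 : FramedGaloisRep F (PadicAlgCl ℓ) m).toGaloisRep.frobCharpoly v).map
        (ι : PadicAlgCl ℓ ≃+* ℂ).toRingHom).roots,
      ‖z‖ = (v.residueCard : ℝ) ^ (((0 : ℤ) : ℝ) / 2) := by
  intro z hz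
  rw [frobCharpoly_one, Polynomial.map_pow, Polynomial.map_sub, Polynomial.map_X,
    Polynomial.map_one, ← C_1, Polynomial.roots_pow, Polynomial.roots_X_sub_C] at hz
  have hz1 : z = 1 := by
    have := Multiset.mem_of_mem_nsmul hz
    simpa using this
  subst hz1
  simp

/-- The hypotheses of the crux are jointly satisfiable (trivial representation, weight `0`). -/
theorem hypotheses_satisfiable (ι : PadicAlgCl ℓ ≃+* ℂ) :
    (∀ᶠ v : HeightOneSpectrum (𝓞 F) in cofinite,
        (1 : FramedGaloisRep F (PadicAlgCl ℓ) m).IsUnramifiedAt v) ∧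
    (∀ (v : HeightOneSpectrum (𝓞 F)) (hv : ((ℓ : ℕ) : 𝓞 F) ∈ v.asIdeal),
      (fontainePstAdicCompletion v ℓ hv).IsDeRhamFramed
        ((1 : FramedGaloisRep F (PadicAlgCl ℓ) m).toLocal v)) ∧
    (∀ᶠ v : HeightOneSpectrum (𝓞 F) in cofinite,
      ∀ z ∈ (((1 : FramedGaloisRep F (PadicAlgCl ℓ) m).toGaloisRep.frobCharpoly v).map
          (ι : PadicAlgCl ℓ ≃+* ℂ).toRingHom).roots,
        ‖z‖ = (v.residueCard : ℝ) ^ (((0 : ℤ) : ℝ) / 2)) :=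
  ⟨Filter.Eventually.of_forall (one_isUnramifiedAt F m ℓ), one_isDeRhamFramed F m ℓ,
    Filter.Eventually.of_forall (one_pure F m ℓ ι)⟩

/-- The Frobenius trace of the trivial rank-`m` representation is `m` at every place. -/
theorem frobTrace_one (v : HeightOneSpectrum (𝓞 F)) :
    (1 : FramedGaloisRep F (PadicAlgCl ℓ) m).toGaloisRep.frobTrace v = m := by
  rw [GaloisRep.frobTrace, frobCharpoly_one]
  have : ((X - 1 : (PadicAlgCl ℓ)[X]) ^ m) = ((Multiset.replicate m (1 : PadicAlgCl ℓ)).map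
      (fun a => X - C a)).prod := by
    simp
  rw [this, Polynomial.multiset_prod_X_sub_C_nextCoeff]
  simp


/-! ### The degenerate instance `ρ = 1` satisfies the conclusion, sharply -/

open Literature.NumberTheory.LFunctions in
/-- `Σ_v N(v)^{-σ} / log (1/(σ-1)) → 1` as `σ → 1⁺` (Dedekind pole), in the crux's notation
`v.residueCard`. -/
theorem tendsto_tsum_residueCard_rpow_neg_div_log :
    Tendsto (fun σ : ℝ => (∑' v : HeightOneSpectrum (𝓞 F), (v.residueCard : ℝ) ^ (-σ)) /
      Real.log (1 / (σ - 1))) (𝓝[>] (1 : ℝ)) (𝓝 1) := by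
  have h := NumberField.tendsto_tsum_indicator_absNorm_div_log
    (hasStrongDirichletDensity_univ F)
  refine h.congr' (Filter.Eventually.of_forall fun s => ?_)
  congr 1
  exact tsum_congr fun v => by rw [if_pos (Set.mem_univ v)]; rfl

/-- The summand of the crux for `ρ = 1`, `w = 0`: `m² · N(v)^{-σ}`. -/
theorem summand_trivialRep (ι : PadicAlgCl ℓ ≃+* ℂ) (v : HeightOneSpectrum (𝓞 F)) (σ : ℝ) :
    ‖(ι : PadicAlgCl ℓ ≃+* ℂ) ((1 : FramedGaloisRep F (PadicAlgCl ℓ) m).toGaloisRep.frobTrace v)‖ ^ 2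
        * (v.residueCard : ℝ) ^ (-(((0 : ℤ) : ℝ) + σ)) =
      (m : ℝ) ^ 2 * (v.residueCard : ℝ) ^ (-σ) := by
  rw [frobTrace_one, map_natCast, Complex.norm_natCast, Int.cast_zero, zero_add]

/-- The crux's `∑'` for `ρ = 1`, `w = 0` is `m² · Σ_v N(v)^{-σ}` (a genuine, summable series for
`σ > 1`). -/
theorem tsum_trivialRep (ι : PadicAlgCl ℓ ≃+* ℂ) (σ : ℝ) :
    (∑' v : HeightOneSpectrum (𝓞 F),
        ‖(ι : PadicAlgCl ℓ ≃+* ℂ) ((1 : FramedGaloisRep F (PadicAlgCl ℓ) m).toGaloisRep.frobTrace v)‖ ^ 2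
          * (v.residueCard : ℝ) ^ (-(((0 : ℤ) : ℝ) + σ))) =
      (m : ℝ) ^ 2 * ∑' v : HeightOneSpectrum (𝓞 F), (v.residueCard : ℝ) ^ (-σ) := by
  rw [← tsum_mul_left]
  exact tsum_congr fun v => summand_trivialRep F m ℓ ι v σ

/-- **The conclusion of `MeanSquareTraceAtLeastOne` HOLDS for the trivial representation** of every
rank `m ≥ 1` (weight `w = 0`): the degenerate instance is true, not a counterexample. -/
theorem conclusion_holds_trivialRep (hm : 0 < m) (ι : PadicAlgCl ℓ ≃+* ℂ) (ε : ℝ) (hε : 0 < ε) :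
    ∀ᶠ σ : ℝ in 𝓝[>] (1 : ℝ), (1 - ε) * Real.log (1 / (σ - 1)) ≤
      ∑' v : HeightOneSpectrum (𝓞 F),
        ‖(ι : PadicAlgCl ℓ ≃+* ℂ) ((1 : FramedGaloisRep F (PadicAlgCl ℓ) m).toGaloisRep.frobTrace v)‖ ^ 2
          * (v.residueCard : ℝ) ^ (-(((0 : ℤ) : ℝ) + σ)) := by
  have hT := tendsto_tsum_residueCard_rpow_neg_div_log F
  have hev : ∀ᶠ σ : ℝ in 𝓝[>] (1 : ℝ), 1 - ε <
      (∑' v : HeightOneSpectrum (𝓞 F), (v.residueCard : ℝ) ^ (-σ)) / Real.log (1 / (σ - 1)) :=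
    hT.eventually (Ioi_mem_nhds (by linarith))
  filter_upwards [hev, Literature.NumberTheory.LFunctions.PrimeSum.eventually_log_pos] with σ h1 hlog
  rw [tsum_trivialRep]
  have hS : 0 ≤ ∑' v : HeightOneSpectrum (𝓞 F), (v.residueCard : ℝ) ^ (-σ) :=
    tsum_nonneg fun v => by positivity
  have h2 : (1 - ε) * Real.log (1 / (σ - 1)) <
      ∑' v : HeightOneSpectrum (𝓞 F), (v.residueCard : ℝ) ^ (-σ) := (lt_div_iff₀ hlog).mp h1
  have hm1 : (1 : ℝ) ≤ (m : ℝ) ^ 2 := by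
    have : (1 : ℝ) ≤ m := by exact_mod_cast hm
    nlinarith
  calc (1 - ε) * Real.log (1 / (σ - 1))
      ≤ ∑' v : HeightOneSpectrum (𝓞 F), (v.residueCard : ℝ) ^ (-σ) := h2.le
    _ = 1 * ∑' v : HeightOneSpectrum (𝓞 F), (v.residueCard : ℝ) ^ (-σ) := (one_mul _).symm
    _ ≤ (m : ℝ) ^ 2 * ∑' v : HeightOneSpectrum (𝓞 F), (v.residueCard : ℝ) ^ (-σ) :=
      mul_le_mul_of_nonneg_right hm1 hS

/-- **Tightness at the trivial character**: for `ρ = 1` of rank `1` the constant `1` of the crux is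
attained — replacing `1 - ε` by `1 + δ` (`δ > 0`) makes the conclusion FALSE. -/
theorem conclusion_tight_trivialChar (ι : PadicAlgCl ℓ ≃+* ℂ) (δ : ℝ) (hδ : 0 < δ) :
    ¬ ∀ᶠ σ : ℝ in 𝓝[>] (1 : ℝ), (1 + δ) * Real.log (1 / (σ - 1)) ≤
      ∑' v : HeightOneSpectrum (𝓞 F),
        ‖(ι : PadicAlgCl ℓ ≃+* ℂ) ((1 : FramedGaloisRep F (PadicAlgCl ℓ) 1).toGaloisRep.frobTrace v)‖ ^ 2
          * (v.residueCard : ℝ) ^ (-(((0 : ℤ) : ℝ) + σ)) := by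
  intro h
  have hT := tendsto_tsum_residueCard_rpow_neg_div_log F
  have hev : ∀ᶠ σ : ℝ in 𝓝[>] (1 : ℝ),
      (∑' v : HeightOneSpectrum (𝓞 F), (v.residueCard : ℝ) ^ (-σ)) / Real.log (1 / (σ - 1)) <
        1 + δ :=
    hT.eventually (Iio_mem_nhds (by linarith))
  obtain ⟨σ, h1, h2, hlog⟩ :=
    (h.and (hev.and Literature.NumberTheory.LFunctions.PrimeSum.eventually_log_pos)).exists
  rw [tsum_trivialRep, Nat.cast_one, one_pow, one_mul] at h1
  have h3 : (∑' v : HeightOneSpectrum (𝓞 F), (v.residueCard : ℝ) ^ (-σ)) <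
      (1 + δ) * Real.log (1 / (σ - 1)) := (div_lt_iff₀ hlog).mp h2
  linarith

/-! ### Load-bearing hypotheses: the rank guard `0 < m` and the purity clause (H3) -/

/-- **The guard `0 < m` is load-bearing** (the crux with `0 < m →` deleted, everything else
verbatim, stated inline): in rank `0` the (unique, trivial) representation is
a.e. unramified, de Rham, vacuously pure of any weight, and its mean square is `0 < 1 - ε`.
Witness `F = ℚ`, `m = 0`, `ℓ = 2`, `ρ = 1`, `w = 0`, `ε = 1/2`. -/
theorem meanSquareTrace_false_without_rank_pos : ¬ (
    ∀ (F : Type) [Field F] [NumberField F] (m : ℕ) (ℓ : ℕ) [Fact ℓ.Prime] (ι : PadicAlgCl ℓ ≃+* ℂ)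
      (ρ : FramedGaloisRep F (PadicAlgCl ℓ) m) (w : ℤ),
      (∀ᶠ v : HeightOneSpectrum (𝓞 F) in cofinite, ρ.IsUnramifiedAt v) →
      (∀ (v : HeightOneSpectrum (𝓞 F)) (hv : ((ℓ : ℕ) : 𝓞 F) ∈ v.asIdeal),
        (fontainePstAdicCompletion v ℓ hv).IsDeRhamFramed (ρ.toLocal v)) →
      (∀ᶠ v : HeightOneSpectrum (𝓞 F) in cofinite,
        ∀ z ∈ ((ρ.toGaloisRep.frobCharpoly v).map (ι : PadicAlgCl ℓ ≃+* ℂ).toRingHom).roots,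
          ‖z‖ = (v.residueCard : ℝ) ^ ((w : ℝ) / 2)) →
      ∀ ε : ℝ, 0 < ε → ∀ᶠ σ : ℝ in 𝓝[>] (1 : ℝ), (1 - ε) * Real.log (1 / (σ - 1)) ≤
        ∑' v : HeightOneSpectrum (𝓞 F),
          ‖(ι : PadicAlgCl ℓ ≃+* ℂ) (ρ.toGaloisRep.frobTrace v)‖ ^ 2 *
            (v.residueCard : ℝ) ^ (-((w : ℝ) + σ))) := by
  intro h
  obtain ⟨ι⟩ := PadicAlgCl.nonempty_ringEquiv_complex 2
  have hpure : ∀ᶠ v : HeightOneSpectrum (𝓞 ℚ) in cofinite,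
      ∀ z ∈ (((1 : FramedGaloisRep ℚ (PadicAlgCl 2) 0).toGaloisRep.frobCharpoly v).map
          (ι : PadicAlgCl 2 ≃+* ℂ).toRingHom).roots,
        ‖z‖ = (v.residueCard : ℝ) ^ (((0 : ℤ) : ℝ) / 2) :=
    Filter.Eventually.of_forall fun v z hz => by
      rw [frobCharpoly_one, pow_zero, Polynomial.map_one, Polynomial.roots_one] at hz
      exact absurd hz (Multiset.notMem_zero z)
  have h1 := h ℚ 0 2 ι 1 0 (Filter.Eventually.of_forall (one_isUnramifiedAt ℚ 0 2))
    (one_isDeRhamFramed ℚ 0 2) hpure (1 / 2) (by norm_num)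
  obtain ⟨σ, hσ, hlog⟩ :=
    (h1.and Literature.NumberTheory.LFunctions.PrimeSum.eventually_log_pos).exists
  rw [tsum_trivialRep, Nat.cast_zero, zero_pow two_ne_zero, zero_mul] at hσ
  linarith

open Literature.NumberTheory.LFunctions in
/-- **The purity clause (H3) — equivalently the weight normalisation `N(v)^{-w}` — is
load-bearing** (the crux with H3 deleted, everything else verbatim, stated inline): without it
`w` is free, and for the trivial character with the WRONG weight `w = 2` the series `Σ_v N(v)^{-(2+σ)}` stays bounded by `Σ_v N(v)^{-2}` while `(1-ε) log (1/(σ-1)) → ∞`.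
Witness `F = ℚ`, `m = 1`, `ℓ = 2`, `ρ = 1`, `w = 2`, `ε = 1/2`. -/
theorem meanSquareTrace_false_without_purity : ¬ (
    ∀ (F : Type) [Field F] [NumberField F] (m : ℕ), 0 < m → ∀ (ℓ : ℕ) [Fact ℓ.Prime]
      (ι : PadicAlgCl ℓ ≃+* ℂ) (ρ : FramedGaloisRep F (PadicAlgCl ℓ) m) (w : ℤ),
      (∀ᶠ v : HeightOneSpectrum (𝓞 F) in cofinite, ρ.IsUnramifiedAt v) →
      (∀ (v : HeightOneSpectrum (𝓞 F)) (hv : ((ℓ : ℕ) : 𝓞 F) ∈ v.asIdeal),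
        (fontainePstAdicCompletion v ℓ hv).IsDeRhamFramed (ρ.toLocal v)) →
      ∀ ε : ℝ, 0 < ε → ∀ᶠ σ : ℝ in 𝓝[>] (1 : ℝ), (1 - ε) * Real.log (1 / (σ - 1)) ≤
        ∑' v : HeightOneSpectrum (𝓞 F),
          ‖(ι : PadicAlgCl ℓ ≃+* ℂ) (ρ.toGaloisRep.frobTrace v)‖ ^ 2 *
            (v.residueCard : ℝ) ^ (-((w : ℝ) + σ))) := by
  intro h
  obtain ⟨ι⟩ := PadicAlgCl.nonempty_ringEquiv_complex 2
  have h1 := h ℚ 1 one_pos 2 ι 1 2 (Filter.Eventually.of_forall (one_isUnramifiedAt ℚ 1 2))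
    (one_isDeRhamFramed ℚ 1 2) (1 / 2) (by norm_num)
  -- the bound `B = Σ_v N(v)^{-2}`
  set B : ℝ := ∑' v : HeightOneSpectrum (𝓞 ℚ), (Ideal.absNorm v.asIdeal : ℝ) ^ (-(2 : ℝ)) with hB
  have hlarge : ∀ᶠ σ : ℝ in 𝓝[>] (1 : ℝ), 2 * B + 1 < Real.log (1 / (σ - 1)) :=
    PrimeSum.tendsto_log_one_div_sub_one.eventually_gt_atTop _
  obtain ⟨σ, hσ, hbig, hone⟩ := (h1.and (hlarge.and PrimeSum.eventually_one_lt)).exists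
  have hsum : (∑' v : HeightOneSpectrum (𝓞 ℚ),
      ‖(ι : PadicAlgCl 2 ≃+* ℂ) ((1 : FramedGaloisRep ℚ (PadicAlgCl 2) 1).toGaloisRep.frobTrace v)‖ ^ 2
        * (v.residueCard : ℝ) ^ (-(((2 : ℤ) : ℝ) + σ))) =
      ∑' v : HeightOneSpectrum (𝓞 ℚ), (Ideal.absNorm v.asIdeal : ℝ) ^ (-((2 : ℝ) + σ)) := by
    refine tsum_congr fun v => ?_
    rw [frobTrace_one, map_natCast, Complex.norm_natCast]
    norm_num
    rfl
  have hle : (∑' v : HeightOneSpectrum (𝓞 ℚ), (Ideal.absNorm v.asIdeal : ℝ) ^ (-((2 : ℝ) + σ)))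
      ≤ B := by
    refine Summable.tsum_le_tsum (fun v => NumberField.absNorm_rpow_neg_le_of_le v (by linarith))
      (NumberField.summable_absNorm_rpow_neg (by linarith))
      (NumberField.summable_absNorm_rpow_neg (by norm_num))
  have hBnn : 0 ≤ B := tsum_nonneg fun v => NumberField.absNorm_rpow_neg_nonneg v 2
  rw [hsum] at hσ
  have hlogpos : 0 < Real.log (1 / (σ - 1)) := by linarith
  nlinarith

end Summit.Langlands.Langlands.Theorems.MeanSquareTraceAtLeastOne.Negative
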